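import Summits.BirchSwinnertonDyer.BirchSwinnertonDyer.Theorems.QuadraticBranchSignedControlPlusEtaNonsurjConjADoorBSDRankOne
import Summits.BirchSwinnertonDyer.Rank1Residual.X11b.KrausMinimalityGeneralTwo
import Summits.BirchSwinnertonDyer.BirchSwinnertonDyer.Theorems.QuadraticBranchSignedControlPlusEtaNonsurjConjADoorMinusRecords
import HarnessLib

/-!
# Route `QuadraticBranchSignedControl` (rung K8, cell `bsd-potss`), residual crux `PlusEtaMainConjectureNonsurj`
# (stmt-BirchSwinnertonDyer-19606): `BSD_5` RECORDS V(a) — `MissingPPartAt W 5` on the IN-TABLE prime-`L` rank-ONE partner rows that g21 carried to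
# (C1⁺_η)@5 by name through door L6⁻ (260100e1, 326700fg1, 357075br1; part V(b): the door-L2 rows), modulo the route's declared residual C-cc-1 AT THE ROW (seat `bsd-potss-k8eta-c2` g22)

WHAT. g21's records (p703871 `EtaConjADoorMinusRecords`, p708181 `EtaConjADoorEigenRecords`) give (C1⁺_η)@5 by name on these in-table K8 partner rows `W` (Cremona labels; `ε(W) = −1`, PARI plus-`η`
`(λ, μ) = (1, 0)`, `r_an(W) = 1`; census k8eta-c2 g19–g21, GRH). This seat's per-row rank-one assembly (`EtaConjADoorBSDRankOne`, p718742: x1b's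
odd-branch chain with Poitou–Tate a tree theorem, the layer comparison proved, (R2⁻) from Kitajima–Otsuki, the exact odd reading from Kobayashi
Thm. 7.4, Mazur's period ratio) turns each into Miller's `BSDp W 5`, hence `MissingPPartAt W 5` (`ord₅ #Ш(W) = ord₅ #Ш_an(W)`; `Ш(W)` finite by GZK),
CONDITIONAL on the named published facts `hGZK hmod hnf hM h12 hKO hGZ h74 h22 h41 h6273` and on the displayed per-row instance of the route's OPEN
crux C-cc-1 (item 19116) `QuadraticBranchMinusLeadingValuationAt W 5 0` — NOT certified here. Kernel: global minimality of each `W` (Kraus/Silverman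
support certificate, `decide`); `Δ ≠ 0` reused from g21's record files. WHY IT MATTERS: the CM rows here are rank ONE at an ADDITIVE prime inert in
the CM field — the cell's CornerF, excluded from the tree's `bsdp_allCurves_of_not_corner_of_not_cornerF`; these records say that on them `BSD(W,5)` is exactly
«named published facts + C-cc-1 at the curve» (class-group numerics and PARI certificates displayed).

HONEST FRAMING (cell `bsd-potss`; FULL-BSD rank ≤ 1 programme, HUMAN RULING D-0036/D-0074): per-row RECORDS, CONDITIONAL as displayed; `BSD(W,5)`
ASSERTED for no pair; no stub of 19606 proved; crux and route OPEN; nothing booked; no residue count moves. `--supports stmt-BirchSwinnertonDyer-19606`.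

References: [Kobayashi2003] Thm. 1.2, 2.2, §4, Thm. 4.1, 6.2–7.4, 9.3; [Kobayashi2013]; [KitajimaOtsuki2018] Main Thm. 1.3; [GrossZagier1986] Thm. I.(7.3);
[Mazur1978] Cor. 4.1; [Miller2011LMS] Def. 1.1; [CoatesSujatha2005] §3 (A); [DeoRaySujatha2023] Thm. 3.8; [SilvermanAEC2009] VII.1 Rem. 1.1;
[Cremona1997] Table 1.
-/

set_option autoImplicit false
set_option linter.dupNamespace false
noncomputable section

open scoped Classical nonZeroDivisors

open CongruenceSubgroup NumberField Field WeierstrassCurve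
open Literature.NumberTheory.EllipticCurves Literature.NumberTheory.EllipticCurves.ModularForms
  Literature.NumberTheory.EllipticCurves.Rank1Residual Literature.NumberTheory.EllipticCurves.Rank1Residual.Typed
  Literature.NumberTheory.GaloisRepresentations Literature.NumberTheory.GaloisCohomology Literature.NumberTheory.NumberFields
  Literature.NumberTheory.EllipticCurves.GreenbergVatsal2000 ZpExtension
open Summit.BirchSwinnertonDyer.Rank1Residual Summit.BirchSwinnertonDyer.Rank1Residual.Additive
open Summit.BirchSwinnertonDyer.Rank1Residual.X11b (isElliptic_of_discOf_ne_zero)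
open Summit.BirchSwinnertonDyer.BirchSwinnertonDyer.Theorems
open Summit.BirchSwinnertonDyer.Rank1Residual.X11b (isGloballyMinimal_of_krausCriterion_support)

namespace Summit.BirchSwinnertonDyer.BirchSwinnertonDyer.Theorems.EtaConjADoorBSDRecordsR1

set_option maxRecDepth 100000 in
/-- `W = [0, 0, 0, 0, 10440125]` is a global minimal equation (Silverman VII.1 Rem. 1.1 on the support `|Δ| = 2^4 · 3^3 · 5^6 · 17^8` — at every
prime `q` of the support `q¹² ∤ Δ` or `q⁴ ∤ c₄`, or Kraus's test at `2`; tree `isGloballyMinimal_of_krausCriterion_support`, kernel `decide`).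
[cite: SilvermanAEC2009, VII.1 Remark 1.1] [cite: Kraus1989, Prop. 1 and Prop. 2] -/
theorem isGloballyMinimal_260100e1 : (⟨0, 0, 0, 0, 10440125⟩ : WeierstrassCurve ℚ).IsGloballyMinimal :=
  isGloballyMinimal_of_krausCriterion_support 0 0 0 0 10440125 [(2, 0, 4), (3, 0, 3), (5, 0, 6), (17, 0, 8)]
    (by
      intro t ht
      simp only [List.mem_cons, List.not_mem_nil, or_false] at ht
      rcases ht with rfl | rfl | rfl | rfl <;> norm_num)
    (by decide +kernel) (by decide +kernel)

/-- **`MissingPPartAt W 5` — `ord_5 #Ш(W) = ord_5 #Ш_an(W)` (from Miller's `BSDp W 5`) — for the CM in-table partner (the cell's CornerF: CM, rank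
one, additive `p` non-split in the CM field — excluded from the tree's `bsdp_allCurves_of_not_corner_of_not_cornerF`), prime-`L` rank-one partner
260100e1, granted ONE good `a_5 = 0` globally minimal model `V` of `W^{(5)}` with non-onto `5`-adic tower AND the route's residual crux C-cc-1 AT
THIS ROW** (`W = [0, 0, 0, 0, 10440125]`, CM, `N_W = 260100`; kit j326603 (k8eta-c2 g21) (GRH): `ε(W) = −1`, PARI plus-`η` `(λ, μ) = (1, 0)`,
`r_an(W) = 1` (`k8eta-c2 g19/g20 census`); `h(ℚ(P)) = 45`, `h(ℚ(x(P))) = 45`; eigen dimensions `(d₁,d₂,d₃,d₄) = (0,0,0,1)` — door L6⁻ (relative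
class number) passes) from the ROW ALONE — named facts `hGZK hmod hnf hM h12 hKO hGZ h74 h22 h41 h6273` (GZK, modularity, newforms, Mazur `p ∤ c₀`,
Kobayashi Thm. 1.2 / 2.2 / 4.1 / 6.2–7.4, Kitajima–Otsuki Thm. 1.3, Gross–Zagier I (7.3); Poitou–Tate and the layer comparison are tree theorems);
displayed: `r_an(W) = 1`, the twin `V` with the tower clause, `(L_5⁺(V,η,X)) = (X)`, and the route's DECLARED RESIDUAL crux C-cc-1 AT THIS ROW
(`QuadraticBranchMinusLeadingValuationAt W 5 0`, the regulator-free `δ = 0` valuation law — OPEN, not certified here), the class-group datum.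
Instance of `EtaConjADoorBSDRankOne.bsdp_r1_of_relClassNumber` (k8eta-c2 g22). CONDITIONAL; nothing booked. [cite: Kobayashi2003, §4 (p. 8), Thm.
2.2 (p. 5)] [cite: CoatesSujatha2005, §3 (A) and Thm. 3.4] [cite: Cremona1997, Table 1] -/
theorem missingPPartAt_r1_260100e1_5_of_relClassNumber
    (hGZK : rank_eq_analyticRank_of_analyticRank_le_one) (hmod : hasEntireLFunction_rat)
    (hnf : exists_isNewformOf) (hM : mazur_not_dvd_maninConstant_of_odd)
    (h12 : Kobayashi2003.thm12_signedSelmerDual_finite_torsion)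
    (hKO : KitajimaOtsuki2018.mainThm13_etaSignedSelmerDual_noFiniteSubmodule)
    (hGZ : GrossZagier1986_thm_I_7_3) (h74 : Kobayashi2003.thm74_etaEvenMC_iff_etaOddMC)
    (h22 : Kobayashi2003.thm22_etaSignedSelmerDual_finite_torsion)
    (h41 : Kobayashi2003.thm41_plusEtaCharIdeal_dvd)
    (h6273 : Kobayashi2003.thm62_63_73_etaColemanPoitouTate) [Fact (5 : ℕ).Prime]
    (W : WeierstrassCurve ℚ) (hW : W = (⟨0, 0, 0, 0, 10440125⟩ : WeierstrassCurve ℚ)) (hr : W.analyticRank = 1)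
    (V : WeierstrassCurve ℚ) [V.IsElliptic] [V.IsGloballyMinimal] (C : VariableChange ℚ)
    (hC : C • W.quadraticTwist 5 = V)
    (hgood : V.HasGoodReductionAtPrime 5) (hap : V.frobeniusTrace 5 = 0)
    (hns : ¬ ∀ m : ℕ, V.HasSurjectiveModNGaloisRep (5 ^ m : ℕ))
    (hX : ∀ {N : ℕ} [NeZero N] {f : CuspForm (Gamma0 N) 2}, IsNewformOf V f →
      ∀ (ϖ : ℚ), (if Even (5 / 2) then (ϖ : ℝ) * V.realPeriodRat = plusPeriod f
          else (ϖ : ℝ) * V.imaginaryPeriodRat = minusPeriod f) →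
      ∀ (Lη : IwasawaAlgebra 5), IsQuadraticBranchPlusLFunction f 5 ϖ Lη →
        Ideal.span {Lη} = Ideal.span {(PowerSeries.X : IwasawaAlgebra 5)})
    (hP : haveI : W.IsElliptic := hW ▸ Summit.BirchSwinnertonDyer.BirchSwinnertonDyer.Theorems.EtaConjADoorMinusRecords.isElliptic_260100e1
      haveI : NeZero (5 : ℕ) := ⟨by norm_num⟩
      haveI : NumberField (W.divisionField 5) := NumberField.mk
      ∃ P : geomTorsion W ((5 : ℕ) : ℤ), P ≠ 0 ∧ ∀ τ : absoluteGaloisGroup ℚ, τ • P = -P →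
        ∀ K : IntermediateField ℚ (W.divisionField 5),
          K = IntermediateField.fixedField
            ((MulAction.stabilizer (absoluteGaloisGroup ℚ) P).map (absRestrictNormalHom (W.divisionField 5))) →
        ∀ σ : K ≃ₐ[ℚ] K,
          (∀ x : K, absRestrictNormalHom (W.divisionField 5) τ (x : W.divisionField 5) =
            ((σ x : K) : W.divisionField 5)) →
          padicValNat 5 (NumberField.classNumber K) ≤
            padicValNat 5 (NumberField.classNumber (IntermediateField.fixedField (Subgroup.zpowers σ))))
    (hcc1 : haveI : W.IsElliptic := hW ▸ Summit.BirchSwinnertonDyer.BirchSwinnertonDyer.Theorems.EtaConjADoorMinusRecords.isElliptic_260100e1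
      haveI : W.IsGloballyMinimal := hW ▸ isGloballyMinimal_260100e1
      QuadraticBranchMinusLeadingValuationAt W 5 0) :
    MissingPPartAt W 5 := by
  subst hW
  haveI : (⟨0, 0, 0, 0, 10440125⟩ : WeierstrassCurve ℚ).IsElliptic := Summit.BirchSwinnertonDyer.BirchSwinnertonDyer.Theorems.EtaConjADoorMinusRecords.isElliptic_260100e1
  haveI : (⟨0, 0, 0, 0, 10440125⟩ : WeierstrassCurve ℚ).IsGloballyMinimal := isGloballyMinimal_260100e1
  haveI : NeZero (5 : ℕ) := ⟨by norm_num⟩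
  haveI : Finite (⟨0, 0, 0, 0, 10440125⟩ : WeierstrassCurve ℚ).sha := (hGZK _ (by omega)).2
  exact missingPPartAt_of_bsdp _ 5 (EtaConjADoorBSDRankOne.bsdp_r1_of_relClassNumber _ 5 hGZK hmod hnf hM h12 hKO hGZ h74 h22 h41 h6273 (le_refl 5) hr V C
    (by rw [show ((-1 : ℚ) ^ ((5 : ℕ) / 2) * ((5 : ℕ) : ℚ)) = 5 by norm_num]; exact hC) hgood hap hns hX hP hcc1)

set_option maxRecDepth 100000 in
/-- `W = [0, 0, 0, 0, 60500]` is a global minimal equation (Silverman VII.1 Rem. 1.1 on the support `|Δ| = 2^8 · 3^3 · 5^6 · 11^4` — at every prime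
`q` of the support `q¹² ∤ Δ` or `q⁴ ∤ c₄`, or Kraus's test at `2`; tree `isGloballyMinimal_of_krausCriterion_support`, kernel `decide`). [cite:
SilvermanAEC2009, VII.1 Remark 1.1] [cite: Kraus1989, Prop. 1 and Prop. 2] -/
theorem isGloballyMinimal_326700fg1 : (⟨0, 0, 0, 0, 60500⟩ : WeierstrassCurve ℚ).IsGloballyMinimal :=
  isGloballyMinimal_of_krausCriterion_support 0 0 0 0 60500 [(2, 0, 8), (3, 0, 3), (5, 0, 6), (11, 0, 4)]
    (by
      intro t ht
      simp only [List.mem_cons, List.not_mem_nil, or_false] at ht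
      rcases ht with rfl | rfl | rfl | rfl <;> norm_num)
    (by decide +kernel) (by decide +kernel)

/-- **`MissingPPartAt W 5` — `ord_5 #Ш(W) = ord_5 #Ш_an(W)` (from Miller's `BSDp W 5`) — for the CM in-table partner (the cell's CornerF: CM, rank
one, additive `p` non-split in the CM field — excluded from the tree's `bsdp_allCurves_of_not_corner_of_not_cornerF`), prime-`L` rank-one partner
326700fg1, granted ONE good `a_5 = 0` globally minimal model `V` of `W^{(5)}` with non-onto `5`-adic tower AND the route's residual crux C-cc-1 AT
THIS ROW** (`W = [0, 0, 0, 0, 60500]`, CM, `N_W = 326700`; kit j326603 (GRH): `ε(W) = −1`, PARI plus-`η` `(λ, μ) = (1, 0)`, `r_an(W) = 1` (`k8eta-c2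
g19/g20 census`); `h(ℚ(P)) = 45`, `h(ℚ(x(P))) = 45`; eigen dimensions `(d₁,d₂,d₃,d₄) = (0,0,0,1)` — door L6⁻ (relative class number) passes) from
the ROW ALONE — named facts `hGZK hmod hnf hM h12 hKO hGZ h74 h22 h41 h6273` (GZK, modularity, newforms, Mazur `p ∤ c₀`, Kobayashi Thm. 1.2 / 2.2 /
4.1 / 6.2–7.4, Kitajima–Otsuki Thm. 1.3, Gross–Zagier I (7.3); Poitou–Tate and the layer comparison are tree theorems); displayed: `r_an(W) = 1`,
the twin `V` with the tower clause, `(L_5⁺(V,η,X)) = (X)`, and the route's DECLARED RESIDUAL crux C-cc-1 AT THIS ROW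
(`QuadraticBranchMinusLeadingValuationAt W 5 0`, the regulator-free `δ = 0` valuation law — OPEN, not certified here), the class-group datum.
Instance of `EtaConjADoorBSDRankOne.bsdp_r1_of_relClassNumber` (k8eta-c2 g22). CONDITIONAL; nothing booked. [cite: Kobayashi2003, §4 (p. 8), Thm.
2.2 (p. 5)] [cite: CoatesSujatha2005, §3 (A) and Thm. 3.4] [cite: Cremona1997, Table 1] -/
theorem missingPPartAt_r1_326700fg1_5_of_relClassNumber
    (hGZK : rank_eq_analyticRank_of_analyticRank_le_one) (hmod : hasEntireLFunction_rat)
    (hnf : exists_isNewformOf) (hM : mazur_not_dvd_maninConstant_of_odd)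
    (h12 : Kobayashi2003.thm12_signedSelmerDual_finite_torsion)
    (hKO : KitajimaOtsuki2018.mainThm13_etaSignedSelmerDual_noFiniteSubmodule)
    (hGZ : GrossZagier1986_thm_I_7_3) (h74 : Kobayashi2003.thm74_etaEvenMC_iff_etaOddMC)
    (h22 : Kobayashi2003.thm22_etaSignedSelmerDual_finite_torsion)
    (h41 : Kobayashi2003.thm41_plusEtaCharIdeal_dvd)
    (h6273 : Kobayashi2003.thm62_63_73_etaColemanPoitouTate) [Fact (5 : ℕ).Prime]
    (W : WeierstrassCurve ℚ) (hW : W = (⟨0, 0, 0, 0, 60500⟩ : WeierstrassCurve ℚ)) (hr : W.analyticRank = 1)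
    (V : WeierstrassCurve ℚ) [V.IsElliptic] [V.IsGloballyMinimal] (C : VariableChange ℚ)
    (hC : C • W.quadraticTwist 5 = V)
    (hgood : V.HasGoodReductionAtPrime 5) (hap : V.frobeniusTrace 5 = 0)
    (hns : ¬ ∀ m : ℕ, V.HasSurjectiveModNGaloisRep (5 ^ m : ℕ))
    (hX : ∀ {N : ℕ} [NeZero N] {f : CuspForm (Gamma0 N) 2}, IsNewformOf V f →
      ∀ (ϖ : ℚ), (if Even (5 / 2) then (ϖ : ℝ) * V.realPeriodRat = plusPeriod f
          else (ϖ : ℝ) * V.imaginaryPeriodRat = minusPeriod f) →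
      ∀ (Lη : IwasawaAlgebra 5), IsQuadraticBranchPlusLFunction f 5 ϖ Lη →
        Ideal.span {Lη} = Ideal.span {(PowerSeries.X : IwasawaAlgebra 5)})
    (hP : haveI : W.IsElliptic := hW ▸ Summit.BirchSwinnertonDyer.BirchSwinnertonDyer.Theorems.EtaConjADoorMinusRecords.isElliptic_326700fg1
      haveI : NeZero (5 : ℕ) := ⟨by norm_num⟩
      haveI : NumberField (W.divisionField 5) := NumberField.mk
      ∃ P : geomTorsion W ((5 : ℕ) : ℤ), P ≠ 0 ∧ ∀ τ : absoluteGaloisGroup ℚ, τ • P = -P →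
        ∀ K : IntermediateField ℚ (W.divisionField 5),
          K = IntermediateField.fixedField
            ((MulAction.stabilizer (absoluteGaloisGroup ℚ) P).map (absRestrictNormalHom (W.divisionField 5))) →
        ∀ σ : K ≃ₐ[ℚ] K,
          (∀ x : K, absRestrictNormalHom (W.divisionField 5) τ (x : W.divisionField 5) =
            ((σ x : K) : W.divisionField 5)) →
          padicValNat 5 (NumberField.classNumber K) ≤
            padicValNat 5 (NumberField.classNumber (IntermediateField.fixedField (Subgroup.zpowers σ))))
    (hcc1 : haveI : W.IsElliptic := hW ▸ Summit.BirchSwinnertonDyer.BirchSwinnertonDyer.Theorems.EtaConjADoorMinusRecords.isElliptic_326700fg1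
      haveI : W.IsGloballyMinimal := hW ▸ isGloballyMinimal_326700fg1
      QuadraticBranchMinusLeadingValuationAt W 5 0) :
    MissingPPartAt W 5 := by
  subst hW
  haveI : (⟨0, 0, 0, 0, 60500⟩ : WeierstrassCurve ℚ).IsElliptic := Summit.BirchSwinnertonDyer.BirchSwinnertonDyer.Theorems.EtaConjADoorMinusRecords.isElliptic_326700fg1
  haveI : (⟨0, 0, 0, 0, 60500⟩ : WeierstrassCurve ℚ).IsGloballyMinimal := isGloballyMinimal_326700fg1
  haveI : NeZero (5 : ℕ) := ⟨by norm_num⟩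
  haveI : Finite (⟨0, 0, 0, 0, 60500⟩ : WeierstrassCurve ℚ).sha := (hGZK _ (by omega)).2
  exact missingPPartAt_of_bsdp _ 5 (EtaConjADoorBSDRankOne.bsdp_r1_of_relClassNumber _ 5 hGZK hmod hnf hM h12 hKO hGZ h74 h22 h41 h6273 (le_refl 5) hr V C
    (by rw [show ((-1 : ℚ) ^ ((5 : ℕ) / 2) * ((5 : ℕ) : ℚ)) = 5 by norm_num]; exact hC) hgood hap hns hX hP hcc1)

set_option maxRecDepth 100000 in
/-- `W = [0, 0, 1, 0, 16531]` is a global minimal equation (Silverman VII.1 Rem. 1.1 on the support `|Δ| = 3^3 · 5^6 · 23^4` — at every prime `q` of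
the support `q¹² ∤ Δ` or `q⁴ ∤ c₄`, or Kraus's test at `2`; tree `isGloballyMinimal_of_krausCriterion_support`, kernel `decide`). [cite:
SilvermanAEC2009, VII.1 Remark 1.1] [cite: Kraus1989, Prop. 1 and Prop. 2] -/
theorem isGloballyMinimal_357075br1 : (⟨0, 0, 1, 0, 16531⟩ : WeierstrassCurve ℚ).IsGloballyMinimal :=
  isGloballyMinimal_of_krausCriterion_support 0 0 1 0 16531 [(3, 0, 3), (5, 0, 6), (23, 0, 4)]
    (by
      intro t ht
      simp only [List.mem_cons, List.not_mem_nil, or_false] at ht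
      rcases ht with rfl | rfl | rfl <;> norm_num)
    (by decide +kernel) (by decide +kernel)

/-- **`MissingPPartAt W 5` — `ord_5 #Ш(W) = ord_5 #Ш_an(W)` (from Miller's `BSDp W 5`) — for the CM in-table partner (the cell's CornerF: CM, rank
one, additive `p` non-split in the CM field — excluded from the tree's `bsdp_allCurves_of_not_corner_of_not_cornerF`), prime-`L` rank-one partner
357075br1, granted ONE good `a_5 = 0` globally minimal model `V` of `W^{(5)}` with non-onto `5`-adic tower AND the route's residual crux C-cc-1 AT
THIS ROW** (`W = [0, 0, 1, 0, 16531]`, CM, `N_W = 357075`; kit j326603 (GRH): `ε(W) = −1`, PARI plus-`η` `(λ, μ) = (1, 0)`, `r_an(W) = 1` (`k8eta-c2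
g19/g20 census`); `h(ℚ(P)) = 15`, `h(ℚ(x(P))) = 15`; eigen dimensions `(d₁,d₂,d₃,d₄) = (0,0,0,1)` — door L6⁻ (relative class number) passes) from
the ROW ALONE — named facts `hGZK hmod hnf hM h12 hKO hGZ h74 h22 h41 h6273` (GZK, modularity, newforms, Mazur `p ∤ c₀`, Kobayashi Thm. 1.2 / 2.2 /
4.1 / 6.2–7.4, Kitajima–Otsuki Thm. 1.3, Gross–Zagier I (7.3); Poitou–Tate and the layer comparison are tree theorems); displayed: `r_an(W) = 1`,
the twin `V` with the tower clause, `(L_5⁺(V,η,X)) = (X)`, and the route's DECLARED RESIDUAL crux C-cc-1 AT THIS ROW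
(`QuadraticBranchMinusLeadingValuationAt W 5 0`, the regulator-free `δ = 0` valuation law — OPEN, not certified here), the class-group datum.
Instance of `EtaConjADoorBSDRankOne.bsdp_r1_of_relClassNumber` (k8eta-c2 g22). CONDITIONAL; nothing booked. [cite: Kobayashi2003, §4 (p. 8), Thm.
2.2 (p. 5)] [cite: CoatesSujatha2005, §3 (A) and Thm. 3.4] [cite: Cremona1997, Table 1] -/
theorem missingPPartAt_r1_357075br1_5_of_relClassNumber
    (hGZK : rank_eq_analyticRank_of_analyticRank_le_one) (hmod : hasEntireLFunction_rat)
    (hnf : exists_isNewformOf) (hM : mazur_not_dvd_maninConstant_of_odd)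
    (h12 : Kobayashi2003.thm12_signedSelmerDual_finite_torsion)
    (hKO : KitajimaOtsuki2018.mainThm13_etaSignedSelmerDual_noFiniteSubmodule)
    (hGZ : GrossZagier1986_thm_I_7_3) (h74 : Kobayashi2003.thm74_etaEvenMC_iff_etaOddMC)
    (h22 : Kobayashi2003.thm22_etaSignedSelmerDual_finite_torsion)
    (h41 : Kobayashi2003.thm41_plusEtaCharIdeal_dvd)
    (h6273 : Kobayashi2003.thm62_63_73_etaColemanPoitouTate) [Fact (5 : ℕ).Prime]
    (W : WeierstrassCurve ℚ) (hW : W = (⟨0, 0, 1, 0, 16531⟩ : WeierstrassCurve ℚ)) (hr : W.analyticRank = 1)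
    (V : WeierstrassCurve ℚ) [V.IsElliptic] [V.IsGloballyMinimal] (C : VariableChange ℚ)
    (hC : C • W.quadraticTwist 5 = V)
    (hgood : V.HasGoodReductionAtPrime 5) (hap : V.frobeniusTrace 5 = 0)
    (hns : ¬ ∀ m : ℕ, V.HasSurjectiveModNGaloisRep (5 ^ m : ℕ))
    (hX : ∀ {N : ℕ} [NeZero N] {f : CuspForm (Gamma0 N) 2}, IsNewformOf V f →
      ∀ (ϖ : ℚ), (if Even (5 / 2) then (ϖ : ℝ) * V.realPeriodRat = plusPeriod f
          else (ϖ : ℝ) * V.imaginaryPeriodRat = minusPeriod f) →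
      ∀ (Lη : IwasawaAlgebra 5), IsQuadraticBranchPlusLFunction f 5 ϖ Lη →
        Ideal.span {Lη} = Ideal.span {(PowerSeries.X : IwasawaAlgebra 5)})
    (hP : haveI : W.IsElliptic := hW ▸ Summit.BirchSwinnertonDyer.BirchSwinnertonDyer.Theorems.EtaConjADoorMinusRecords.isElliptic_357075br1
      haveI : NeZero (5 : ℕ) := ⟨by norm_num⟩
      haveI : NumberField (W.divisionField 5) := NumberField.mk
      ∃ P : geomTorsion W ((5 : ℕ) : ℤ), P ≠ 0 ∧ ∀ τ : absoluteGaloisGroup ℚ, τ • P = -P →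
        ∀ K : IntermediateField ℚ (W.divisionField 5),
          K = IntermediateField.fixedField
            ((MulAction.stabilizer (absoluteGaloisGroup ℚ) P).map (absRestrictNormalHom (W.divisionField 5))) →
        ∀ σ : K ≃ₐ[ℚ] K,
          (∀ x : K, absRestrictNormalHom (W.divisionField 5) τ (x : W.divisionField 5) =
            ((σ x : K) : W.divisionField 5)) →
          padicValNat 5 (NumberField.classNumber K) ≤
            padicValNat 5 (NumberField.classNumber (IntermediateField.fixedField (Subgroup.zpowers σ))))
    (hcc1 : haveI : W.IsElliptic := hW ▸ Summit.BirchSwinnertonDyer.BirchSwinnertonDyer.Theorems.EtaConjADoorMinusRecords.isElliptic_357075br1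
      haveI : W.IsGloballyMinimal := hW ▸ isGloballyMinimal_357075br1
      QuadraticBranchMinusLeadingValuationAt W 5 0) :
    MissingPPartAt W 5 := by
  subst hW
  haveI : (⟨0, 0, 1, 0, 16531⟩ : WeierstrassCurve ℚ).IsElliptic := Summit.BirchSwinnertonDyer.BirchSwinnertonDyer.Theorems.EtaConjADoorMinusRecords.isElliptic_357075br1
  haveI : (⟨0, 0, 1, 0, 16531⟩ : WeierstrassCurve ℚ).IsGloballyMinimal := isGloballyMinimal_357075br1
  haveI : NeZero (5 : ℕ) := ⟨by norm_num⟩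
  haveI : Finite (⟨0, 0, 1, 0, 16531⟩ : WeierstrassCurve ℚ).sha := (hGZK _ (by omega)).2
  exact missingPPartAt_of_bsdp _ 5 (EtaConjADoorBSDRankOne.bsdp_r1_of_relClassNumber _ 5 hGZK hmod hnf hM h12 hKO hGZ h74 h22 h41 h6273 (le_refl 5) hr V C
    (by rw [show ((-1 : ℚ) ^ ((5 : ℕ) / 2) * ((5 : ℕ) : ℚ)) = 5 by norm_num]; exact hC) hgood hap hns hX hP hcc1)

end Summit.BirchSwinnertonDyer.BirchSwinnertonDyer.Theorems.EtaConjADoorBSDRecordsR1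

end
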